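import Summits.ABC.IUTFork.DAGC312zh
import Summits.ABC.IUTFork.Conditional.AbcOfSHwindowFreyRefutation
import Summits.ABC.IUTFork.Conditional.AbcOfSHwindowFreyRefutationEleven
import Summits.ABC.IUTFork.Conditional.AbcOfSHwindowFreyRefutationSeventeen
import Summits.ABC.IUTFork.Conditional.AbcOfSGenuineKWindowThetaContent
import Summits.ABC.IUTFork.Conditional.AbcOfSOrNumKMixContent
import Summits.ABC.IUTFork.Conditional.AbcOfJointLicenceGenuineKContent
import Summits.ABC.IUTFork.Conditional.AbcOfSlotLicenceGenuineKRead
import Summits.ABC.IUTFork.Conditional.AbcOfSGenuineKTameShallowInhabited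
import Summits.ABC.IUTFork.Conditional.AbcOfSGenuineKTameShallowInhabitedTwoRows
import HarnessLib

/-!
# Kernel DAG index — layer C312, part zi (Δ21): APEX STATUS CENSUS v13 — the branch-C (K line) certificates of record after rulings C-R47/C-R49/C-R51
# and the first refutation AT KNOWN DATA (modulo (P6)) of the window binder that v12 named as record, BY NAME (one FQN for letter K2 of D-0079)

index Δ21 · abc-iut-c312-2 gen 6 (filer) per HOME/plan/KERNEL-DAG-SPEC.md v1.3 §4 (3) (apex duty of the index) and the one-name census pattern of
`DAG.cor312_kernel_census_v10/v11` (DAGC312ze/zf) and `DAG.apex_status_v12` (DAGC312zh, Δ20). APPEND-ONLY; PROOF-ONLY (no `def`, no new `Prop`,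
no instance). THIS FILE PROVES NOTHING NEW: it conjoins the STATEMENTS of landed theorems (`PartC312k.StatementOf @thm`) and proves the conjunction by
the tuple of those theorems.

WHAT `apex_status_v13` RECORDS (each conjunct is a theorem ALREADY in the tree, cited by name; ns `Summit.ABC.IUTFork.` omitted):
(0) `DAG.apex_status_v12` (Δ20, p459361) — CARRIED verbatim: `not_hreg_v4` · `not_hvol_v3` · the 18:4xZ record `abc_of_SH_v10K_window_szpiroBadAll`
    (p453137) · `not_hSH_v7K` · `DAG.N_IUTchIII_Thm3_11_inhabited` · `DAG.summit_real_of_statement'`;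
(1) `Conditional.not_hSHwBad_frey` (abc-iut-w6-d102, p467486) — the window binder `hSHwBad` of v12's record p453137 (= p450130's), ITS TYPE VERBATIM
    (identity junction read by abc-iut-C-cert-3, plan/C-SCOREBOARD.md 21:55Z), is FALSE for every family of the certificate's free context binders,
    MODULO ONLY `Cor22.CondP6 (ratPoint λ₃₆₇₇) 13` — (P6), the Galois-image condition at the explicit Frey–Legendre datum of the abc triple
    `2·5¹⁰·13⁴ + 3¹⁵·7·31⁷·45817 = 11⁸·109²·3677³`, taken BY NAME as the one hypothesis; every other input (admissibility as typed, the Szpiro-bad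
    integer inequality, shallowness, non-emptiness via `ThetaPartII.stub_thetaData`, the per-datum ¬S_H row p461349) is kernel-discharged there;
(1′) `Conditional.not_hSHw_frey` (same file) — likewise for the UNCUT window binder `hSHw` of `abc_of_SH_v10K_window` (p447945);
(1″) `Conditional.not_hSHwBad_frey_eleven` (p467802) and `Conditional.not_hSHwBad_frey_seventeen` (p468473) — the same refutation modulo (P6) at
    `l = 11` and `l = 17` (all three primes of the 3677-triple);
(2) `Conditional.abc_of_SH_v10K_window_content` (abc-iut-C-cert-1, p460293) — the CERTIFICATE OF RECORD (K) since C-R47 (18:15Z): `ABC` from three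
    per-datum binders consumed ONLY on the CONTENT LOCUS of [IUTchIV] Thm. 1.10's display («6(1 + 20·d_mod/l)(log-diff + log-cond) + 120·d*_mod·l <
    log q^{∤{2,l}}», which implies Szpiro-bad): `hSHwC` · `hNumC` · `hregC` — explicit 3; UNTOUCHED by (1) by construction (no known datum lies on the
    content locus);
(3) `Conditional.abc_of_SH_orNum_K_mix_content` (C-cert-1, p460539) — STABLE COMPANION, explicit 2 (`hNumOffC` · `hSqMixC`), cone-free;
(4) `Conditional.abc_of_jointLicence_K_content` (abc-iut-C-cert-2, p464272) — LEANEST COMPANION OF RECORD (C-R51), explicit 1 (`hNumJointC`);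
(5) `Conditional.abc_of_slotLicence_orNumP_K_content_read` (C-cert-2, p462946) — γ COMPANION OF RECORD (C-R49), explicit 1 (`hNumPOffC`), the READ-P
    binder discharged by abc-iut-s2-p7's `Thm311.Real.negLogThetaSlot_settingPrVolSharp_pilotDataOfK_chosen_le_datum`;
(6) `Conditional.GenuineK.pilotKummerCompatHull_chosen_of_tame_shallow` (abc-iut-w4-d107, p466297) — POSITIVE INSTANCE SCHEMA: the typed hull-level clause
    S_H HOLDS at every genuine Θ-volume datum whose bad places are all tame and shallow (the class form), and
(6′) `Conditional.GenuineK.pilotKummerCompatHull_chosen_triple_8_185753_185761_seven` (w4-d107, p468460) — a GENUINE ROW of it: S_H holds at every datum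
    over the abc triple `8 + 185753 = 185761`, `l = 7` (Szpiro-good; the first W1 rows by theorem) — so the S_H-type binders are refuted at some genuine
    data (1) and inhabited at other genuine data (6′): neither vacuous nor universally true AS TYPED.
K2 READING (for abc-iut-dag's letter K; numbers, no verdict): record (2) explicit 3 · companions (3)/(4)/(5) explicit 2/1/1 — none of their binders is
refuted as typed at this hour (their loci carry no known datum); REFUTED MODULO (P6) at known data: `hSHwBad` (p453137/p450130) and `hSHw` (p447945)
— the window family v8K…v10K-szpiroBadAll are composition records modulo (P6)@(λ₃₆₇₇, 13 | 11 | 17); REFUTED AS TYPED (v12): `hreg`, `hvol`, un-windowed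
`hSH`; INHABITED AS TYPED at genuine data: S_H at tame shallow data (6)(6′); typed premise node [IUTchIII] Thm 3.11 inhabited, content-free (v12 (e)).

HONEST FRAMING: statements about OUR typed objects; «refuted modulo (P6)» ≠ «refuted» ((P6) at explicit points is numerically witnessed, NOT a kernel
theorem); «refuted as typed» ≠ «refuted in print»; «inhabited as typed» ≠ «true in print»; the per-label licence behind S_H is a STRONGER-THAN-PRINT
sufficient form of Step (xi-f) (abc-iut-w5-d107's framing, adopted cell-wide); the binders `hNumC`/`hregC`/`hNumJointC`/`hNumPOffC` are abc-type
number-level statements («open of abc-type», plan C-R52), never asserted; a cut or a junction discharges nothing. Nothing here asserts that abc is proved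
or refuted or takes a side on [IUTchIII] Cor. 3.12 / [IUTchIV] Thm. 1.10, on the readings (U)/(P), or on any author (Mochizuki / Scholze–Stix / Joshi /
Dupuy–Hilado). typed ≠ discharged; indexed ≠ endorsed. Co-import: the sentinel's F1-SIDES 11:24Z file lists none of the imported modules on side A;
side B of F-w5d064-1 via DAGC312zg (through DAGC312zh). [claim: Mochizuki2012, status: disputed]
[cite: Mochizuki2012, IUTchIII Cor. 3.12 p. 173–174, Step (xi-f) p. 184; IUTchIV Thm. 1.10 pp. 22–31, Cor. 2.2 pp. 43–46]
-/

noncomputable section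

namespace Summit.ABC.IUTFork.DAG

open PartC312k  -- `StatementOf h` := the statement of which `h` is the proof (landed in DAGC312k; re-types nothing, no new definition here)

/-- **APEX STATUS CENSUS v13 (Δ21; one FQN for letter K2).** The conjunction, BY NAME, of: (0) `DAG.apex_status_v12` (Δ20, carried);
(1) `Conditional.not_hSHwBad_frey` — the window binder `hSHwBad` of v12's record `abc_of_SH_v10K_window_szpiroBadAll` (p453137) is FALSE, its type
verbatim, MODULO ONLY (P6) `Cor22.CondP6 (ratPoint λ₃₆₇₇) 13` at the Frey–Legendre datum of the abc triple `2·5¹⁰·13⁴ + 3¹⁵·7·31⁷·45817 =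
11⁸·109²·3677³`; (1′) `Conditional.not_hSHw_frey` — same for the uncut `hSHw` (p447945); (1″) `not_hSHwBad_frey_eleven` / `_seventeen` — same at
`l = 11`, `17`; (2) CERTIFICATE OF RECORD (K) `Conditional.abc_of_SH_v10K_window_content` (explicit 3: hSHwC · hNumC · hregC, content locus; untouched
by (1)); (3) STABLE COMPANION `abc_of_SH_orNum_K_mix_content` (explicit 2); (4) LEANEST COMPANION OF RECORD `abc_of_jointLicence_K_content`
(explicit 1); (5) γ COMPANION OF RECORD `abc_of_slotLicence_orNumP_K_content_read` (explicit 1); (6) POSITIVE INSTANCE schema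
`GenuineK.pilotKummerCompatHull_chosen_of_tame_shallow` and (6′) its genuine row `…_chosen_triple_8_185753_185761_seven` (S_H HOLDS as typed at every
datum over `8 + 185753 = 185761`, `l = 7`). Proof = the tuple of those theorems; proves nothing new; «refuted modulo (P6)» ≠ «refuted»;
«refuted/inhabited as typed» ≠ «in print»; no side taken. [claim: Mochizuki2012, status: disputed] -/
theorem apex_status_v13 :
    StatementOf @Summit.ABC.IUTFork.DAG.apex_status_v12 ∧
    StatementOf @Summit.ABC.IUTFork.Conditional.not_hSHwBad_frey ∧
    StatementOf @Summit.ABC.IUTFork.Conditional.not_hSHw_frey ∧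
    StatementOf @Summit.ABC.IUTFork.Conditional.not_hSHwBad_frey_eleven ∧
    StatementOf @Summit.ABC.IUTFork.Conditional.not_hSHwBad_frey_seventeen ∧
    StatementOf @Summit.ABC.IUTFork.Conditional.abc_of_SH_v10K_window_content ∧
    StatementOf @Summit.ABC.IUTFork.Conditional.abc_of_SH_orNum_K_mix_content ∧
    StatementOf @Summit.ABC.IUTFork.Conditional.abc_of_jointLicence_K_content ∧
    StatementOf @Summit.ABC.IUTFork.Conditional.abc_of_slotLicence_orNumP_K_content_read ∧
    StatementOf @Summit.ABC.IUTFork.Conditional.GenuineK.pilotKummerCompatHull_chosen_of_tame_shallow ∧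
    StatementOf @Summit.ABC.IUTFork.Conditional.GenuineK.pilotKummerCompatHull_chosen_triple_8_185753_185761_seven :=
  ⟨@Summit.ABC.IUTFork.DAG.apex_status_v12,
    @Summit.ABC.IUTFork.Conditional.not_hSHwBad_frey, @Summit.ABC.IUTFork.Conditional.not_hSHw_frey,
    @Summit.ABC.IUTFork.Conditional.not_hSHwBad_frey_eleven, @Summit.ABC.IUTFork.Conditional.not_hSHwBad_frey_seventeen,
    @Summit.ABC.IUTFork.Conditional.abc_of_SH_v10K_window_content, @Summit.ABC.IUTFork.Conditional.abc_of_SH_orNum_K_mix_content,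
    @Summit.ABC.IUTFork.Conditional.abc_of_jointLicence_K_content, @Summit.ABC.IUTFork.Conditional.abc_of_slotLicence_orNumP_K_content_read,
    @Summit.ABC.IUTFork.Conditional.GenuineK.pilotKummerCompatHull_chosen_of_tame_shallow,
    @Summit.ABC.IUTFork.Conditional.GenuineK.pilotKummerCompatHull_chosen_triple_8_185753_185761_seven⟩

end Summit.ABC.IUTFork.DAG

end
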